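import Summits.CriticalPhenomena.PercolationContinuityZ3.Theorems.Transplant.PlanarSkeletonFrmScaledCoarseFrmFrom
import Summits.CriticalPhenomena.PercolationContinuityZ3.Theorems.Transplant.SkelFrmFrom1ServeAt
import HarnessLib

/-!
# U_s execution Us-0 (RULING D-Us, lead g21 V147b; WAVE-Us-MANIFEST v1.0 §2): **THE PROXY PACKAGE AS A HYPOTHESIS** — `PlanarSkeletonFrmFrom.HasProxies Φ t D`
# (every vertex has, within graph distance `D`, a vertex of the same chart position that is a `t`-frame image), the ONE new hypothesis shape the GEN rows thread in place of
# `types = {t}`; the one-type case is the `D = 0` instance; the coarse skeleton of a one-type scaled skeleton has proxies (dictionary parts 4–5)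

builds on p205010 (kernel theorem, internal audit signed; external expert review pending) — nothing in this file uses p205010.  ONE definition (`HasProxies`, a `Prop`; review-queued by
D-0009); no node / statement / `@[conjecture]`; NOTHING about the OPEN nodes U (`SamePDropOfSkeletonFrmFrom₁`) / U_s (`SamePDropOfSkeletonFrmScaled₁`) is claimed.
Lane `prim-bschramm`, seat `prim-bschramm-p3` gen 26 (design owner); helper file (`--supports stmt-CriticalPhenomena-4575 --as helper`).
* §1 `HasProxies`, `HasProxies.of_types_eq` (one type ⇒ proxies with `D = 0`: `c′ = c`), `HasProxies.mono`;
* §2 `HasProxies.mem_fatSeq` (the seed fact of P3-NILPOTENT §19.12 (p4): `c ∈ fatSeq c′ k` for `k ≥ D`, via part 5's `Skelφ.mem_fatSeq_of_mem_graphBall`),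
  `HasProxies.inputsAt` (the served piece-links at the proxy, via Us-1 module 1's `ChoiceNQ.inputsAt_of_atQNQ_frame`);
* §3 `PlanarSkeletonFrmScaled.hasProxies_coarseFrmFrom` (part 5's `exists_proxies_frmFrom`).
[cite: KozmaNitzan2024, §4 pp. 19–21 ((21)–(25): the inputs at every vertex by transitivity)] [cite: BenjaminiSchramm1996, Conj. 4] [this work]
-/

noncomputable section

open scoped Classical

namespace Summit.CriticalPhenomena.PercolationContinuityZ3.Theorems.Transplant

open MeasureTheory Literature.Probability.Percolation Literature.Probability.LatticeModels SimpleGraph KNCells KNLevels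
open Literature.Barriers.CriticalPhenomena (graphBall mem_graphBall_self graphBall_mono)

namespace PlanarSkeletonFrmFrom

variable {V : Type} {G : SimpleGraph V} [G.LocallyFinite]

/-! ## §1 The proxy package -/

/-- **PROXIES at radius `D` for the base vertex `t`**: every vertex `c` has a vertex `c′` within graph distance `D`, at the SAME chart position, which is the image of `t` under
an automorphism translating the chart (so the Step-I inputs of `t` transport to `c′` exactly).  The one-type case is `D = 0` with `c′ = c`; the coarse skeleton of a one-type
scaled skeleton has it with `D = D(Φ)` (dictionary part 4). [this work] -/
def HasProxies (Φ : PlanarSkeletonFrmFrom G) (t : V) (D : ℕ) : Prop :=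
  ∀ c : V, ∃ (c' : V) (α : G ≃g G), α t = c' ∧ (∀ w, Φ.φ (α w) = Φ.φ w + (Φ.φ c' - Φ.φ t)) ∧ Φ.φ c' = Φ.φ c ∧ c ∈ graphBall G c' D

/-- **One type ⇒ proxies at radius `0`** (the proxy of `c` is `c` itself, framed from `t` by `exists_frame_of_types_eq'`): U is the `D = 0` instance of every GEN row. [folklore] -/
theorem HasProxies.of_types_eq (Φ : PlanarSkeletonFrmFrom G) {t : V} (h1 : Φ.types = {t}) : Φ.HasProxies t 0 := by
  intro c
  obtain ⟨α, hαt, hφ⟩ := exists_frame_of_types_eq' Φ h1 c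
  exact ⟨c, α, hαt, hφ, rfl, mem_graphBall_self G c 0⟩

/-- Proxies at radius `D` are proxies at every larger radius. [folklore] -/
theorem HasProxies.mono {Φ : PlanarSkeletonFrmFrom G} {t : V} {D D' : ℕ} (h : Φ.HasProxies t D) (hD : D ≤ D') : Φ.HasProxies t D' := by
  intro c
  obtain ⟨c', α, hαt, hφ, hcell, hball⟩ := h c
  exact ⟨c', α, hαt, hφ, hcell, graphBall_mono G c' hD hball⟩

/-! ## §2 What the junction reads off a proxy -/

/-- **The vertex lies in its proxy's LEVEL-0 seed** once the seed level is `≥ D` (P3-NILPOTENT §19.12 (p4): 'the current cluster ∋ c' ⇒ 'the current cluster meets `Λ c′`').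
[this work] -/
theorem HasProxies.mem_fatSeq [Countable V] {Φ : PlanarSkeletonFrmFrom G} {t : V} {D : ℕ} (h : Φ.HasProxies t D) {p : unitInterval} (hC : Φ.CylSubcritical p)
    (c : V) {k : ℕ} (hk : D ≤ k) :
    ∃ (c' : V) (α : G ≃g G), α t = c' ∧ (∀ w, Φ.φ (α w) = Φ.φ w + (Φ.φ c' - Φ.φ t)) ∧ Φ.φ c' = Φ.φ c ∧
      c ∈ Skelφ.fatSeq (G := G) (φ := Φ.φ) (types := Φ.types) Φ.frame hC c' k := by
  obtain ⟨c', α, hαt, hφ, hcell, hball⟩ := h c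
  exact ⟨c', α, hαt, hφ, hcell, Skelφ.mem_fatSeq_of_mem_graphBall Φ.lip Φ.frame hC hball hk⟩

open SkelConc (Consts)
open Skelφ (oriφ)
open Skelφ.StepI (OutNS eventNAt)

/-- **The served piece-links AT THE PROXY of an arbitrary centre** (`(M, n) ∈ 𝒞.SMn O`): for every `c` there is a proxy `c′` with the same chart position at which the chosen
orientation's served input is `(1 − δI)`-likely — `HasProxies` + Us-1 module 1's `inputsAt_of_atQNQ_frame`.  This is the sentence the GEN rows use where N2/U used
`inputsAt_of_atQNQ … h1 c`. [cite: KozmaNitzan2024, §4 pp. 19–21 ((21)–(25))] -/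
theorem HasProxies.inputsAt [Countable V] {κ : Consts} {Φ : PlanarSkeletonFrmFrom G} {t : V} {D : ℕ} (h : Φ.HasProxies t D) {p : unitInterval}
    {hC : Φ.CylSubcritical p} {O : OutNS V} {q : unitInterval} (𝒞 : ChoiceNQ κ Φ t p hC) (hAt : 𝒞.AtQNQ O q) (c : V) {M n : ℕ} (hMn : (M, n) ∈ 𝒞.SMn O)
    (fam : Fin 2) (τ : ℤˣ) :
    ∃ c' : V, Φ.φ c' = Φ.φ c ∧ c ∈ graphBall G c' D ∧
      1 - 𝒞.δI < (bondPercolation G q).real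
        (eventNAt G (oriφ Φ.φ (O.ori t M n)) O.merged.toDataN t c' (M, some (n, fam, Skelφ.StepI.sgQ O.qd O.qdT O.ori t M n fam, τ))) := by
  obtain ⟨c', α, hαt, hφ, hcell, hball⟩ := h c
  exact ⟨c', hcell, hball, ChoiceNQ.inputsAt_of_atQNQ_frame 𝒞 hAt hαt hφ hMn fam τ⟩

end PlanarSkeletonFrmFrom

/-! ## §3 The coarse skeleton of a one-type scaled skeleton has proxies -/

namespace PlanarSkeletonFrmScaled

variable {V : Type} {G : SimpleGraph V} [G.LocallyFinite] (Φ : PlanarSkeletonFrmScaled G)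

/-- **The coarse skeleton has proxies** (connected `G`, one type, `L ≤ N`): `∃ D, (coarseFrmFrom).HasProxies t D` — dictionary part 4 through part 5. [this work] -/
theorem hasProxies_coarseFrmFrom (hc : G.Connected) {t : V} (h1 : Φ.types = {t}) (hLN : Φ.L ≤ Φ.N) :
    ∃ D : ℕ, (Φ.coarseFrmFrom h1 hLN).HasProxies t D :=
  Φ.exists_proxies_frmFrom hc h1 hLN

end PlanarSkeletonFrmScaled

end Summit.CriticalPhenomena.PercolationContinuityZ3.Theorems.Transplant

end
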